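import Literature.NumberTheory.GaloisCohomology.Howard2004.ConclusionCurrencyProofs
import Mathlib.Data.Fintype.Pigeonhole
import HarnessLib

/-!
# Currency of Howard's Theorem 1.6.1 conclusion, II: `𝒟 ⊕ M ⊕ M` is `𝔪`-power torsion
# (`𝒟 = Frac(R)/R` over a DVR, `M` finite over a local ring) — proofs file

Topic `NumberTheory/GaloisCohomology/Howard2004` (sequel to `ConclusionCurrencyProofs`, p642968). THEOREMS ONLY: no
definition, no named fact, no instance, no `sorry`.

WHY (cell `pub/bsd-print-x9`, shared μ-crux `MuInequalityCoherentPair{OfHoward,OfPrint}`, STUB B `stub_controlGlue`, DISCRETE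
half, seat `bsd-line-x10b-p1-w2` g10, claim (DG3)). The `Λ`-compatibility of the readout of Howard's discrete Selmer module
(`IwasawaDual.IsDualPair.toDual_smul_apply_eq_of_X_compat`, p665265) is proved for honest `Λ`-modules whose elements are
killed by powers of `p` and of `T`; the honest module in question is Thm. 1.6.1's `𝒟 ⊕ M ⊕ M` over `S_m = Λ/(T^m + p)`,
a DVR with uniformizer `π = T mod (T^m + p)` and `p = −π^m`. This file records that every element of `FracModR R × (M × M)`
is killed by a power of the uniformizer (generic `R`):

* `FracModR.exists_pow_smul_eq_zero` — for a DVR `R` with `𝔪 = (ϖ)`: every `d ∈ Frac(R)/R` is killed by some `ϖ^N`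
  (`d = [a/b]`, `b = u ϖ^n`);
* `exists_pow_smul_eq_zero_of_mem_maximalIdeal_of_finite` — for a local `R`, `ϖ ∈ 𝔪` and a FINITE `R`-module `M`: every
  `y ∈ M` is killed by some `ϖ^N` (pigeonhole `ϖ^i y = ϖ^j y`, `1 − ϖ^{j−i}` a unit);
* `pow_smul_eq_zero_of_le` — monotonicity in `N`; `FracModR.exists_pow_smul_prod_eq_zero` — the product `𝒟 × (M × M)`.

References: [Howard2004HeegnerKolyvagin] Thm. 1.6.1 (arXiv:1202.6340 Thm. 2.6.1, p. 11 L17–28: `𝒟 = Φ/R`, `M` finite) and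
§2.2 (`S_𝔮` a DVR); [SerreLocalFields1979] I §2 (structure of DVRs: `x = u ϖ^n`).  BSD is not proved by any of this.
-/

set_option autoImplicit false

noncomputable section

open scoped nonZeroDivisors

namespace Literature.NumberTheory.GaloisCohomology.Howard2004

/-! ## §1 Monotonicity -/

/-- If `ϖ^N • y = 0` then `ϖ^N' • y = 0` for every `N' ≥ N`. [cite: SerreLocalFields1979, Ch. I §2] -/
theorem pow_smul_eq_zero_of_le {R : Type*} [CommRing R] {M : Type*} [AddCommGroup M] [Module R M] (ϖ : R) {y : M}
    {N N' : ℕ} (hN : ϖ ^ N • y = 0) (hle : N ≤ N') : ϖ ^ N' • y = 0 := by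
  obtain ⟨d, rfl⟩ := Nat.exists_eq_add_of_le hle
  rw [add_comm, pow_add, mul_smul, hN, smul_zero]

/-! ## §2 `𝒟 = Frac(R)/R` is `ϖ`-power torsion -/

/-- **Every element of `𝒟 = Frac(R)/R` (`R` a DVR, `𝔪 = (ϖ)`) is killed by a power of `ϖ`**: for `d = [a/b]` write
`b = u ϖ^n`; then `ϖ^n • (a/b) = u⁻¹ a ∈ R`. [cite: Howard2004HeegnerKolyvagin, §1.6 (arXiv p. 11, L18–19: 𝒟 = Φ/R)]
[cite: SerreLocalFields1979, Ch. I §2] -/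
theorem FracModR.exists_pow_smul_eq_zero (R : Type) [CommRing R] [IsDomain R] [IsDiscreteValuationRing R] {ϖ : R}
    (hϖ : IsLocalRing.maximalIdeal R = Ideal.span {ϖ}) (d : FracModR R) : ∃ N : ℕ, ϖ ^ N • d = 0 := by
  have hirr : Irreducible ϖ := (IsDiscreteValuationRing.irreducible_iff_uniformizer ϖ).mpr hϖ
  obtain ⟨q, rfl⟩ := Submodule.Quotient.mk_surjective (p := (1 : Submodule R (FractionRing R))) d
  obtain ⟨x, rfl⟩ := IsLocalization.mk'_surjective R⁰ q
  have hb : (x.2 : R) ≠ 0 := nonZeroDivisors.ne_zero x.2.2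
  obtain ⟨n, u, hu⟩ := IsDiscreteValuationRing.eq_unit_mul_pow_irreducible hb hirr
  refine ⟨n, ?_⟩
  rw [← Submodule.Quotient.mk_smul, Submodule.Quotient.mk_eq_zero, Submodule.mem_one]
  refine ⟨(↑u⁻¹ : R) * x.1, ?_⟩
  rw [Algebra.smul_def]
  have hb' : algebraMap R (FractionRing R) (x.2 : R) =
      algebraMap R (FractionRing R) (u : R) * algebraMap R (FractionRing R) (ϖ ^ n) := by
    rw [← map_mul, ← hu]
  have hu' : algebraMap R (FractionRing R) (↑u⁻¹ : R) * algebraMap R (FractionRing R) (u : R) = 1 := by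
    rw [← map_mul, Units.inv_mul, map_one]
  have hspec : IsLocalization.mk' (FractionRing R) x.1 x.2 * algebraMap R (FractionRing R) (x.2 : R) =
      algebraMap R (FractionRing R) x.1 := IsLocalization.mk'_spec _ x.1 x.2
  calc algebraMap R (FractionRing R) ((↑u⁻¹ : R) * x.1)
      = algebraMap R (FractionRing R) (↑u⁻¹ : R) *
          (IsLocalization.mk' (FractionRing R) x.1 x.2 * algebraMap R (FractionRing R) (x.2 : R)) := by
        rw [hspec, map_mul]
    _ = (algebraMap R (FractionRing R) (↑u⁻¹ : R) * algebraMap R (FractionRing R) (u : R)) *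
          (algebraMap R (FractionRing R) (ϖ ^ n) * IsLocalization.mk' (FractionRing R) x.1 x.2) := by
        rw [hb']; ring
    _ = algebraMap R (FractionRing R) (ϖ ^ n) * IsLocalization.mk' (FractionRing R) x.1 x.2 := by
        rw [hu', one_mul]

/-! ## §3 A finite module over a local ring is `ϖ`-power torsion -/

/-- **Every element of a FINITE module over a local ring is killed by a power of any `ϖ ∈ 𝔪`**: the orbit `k ↦ ϖ^k • y`
is finite, so `ϖ^i • y = ϖ^j • y` for some `i < j`, i.e. `(1 − ϖ^{j−i}) • ϖ^i • y = 0` with `1 − ϖ^{j−i}` a unit.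
[cite: Howard2004HeegnerKolyvagin, Thm. 1.6.1 (arXiv p. 11, L26: «a finite R-module M»)] -/
theorem exists_pow_smul_eq_zero_of_mem_maximalIdeal_of_finite {R : Type*} [CommRing R] [IsLocalRing R] {ϖ : R}
    (hϖ : ϖ ∈ IsLocalRing.maximalIdeal R) {M : Type*} [AddCommGroup M] [Module R M] [Finite M] (y : M) :
    ∃ N : ℕ, ϖ ^ N • y = 0 := by
  obtain ⟨i, j, hij, h⟩ := Finite.exists_ne_map_eq_of_infinite (fun k : ℕ ↦ ϖ ^ k • y)
  wlog hlt : i < j generalizing i j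
  · exact this j i hij.symm h.symm (lt_of_le_of_ne (not_lt.mp hlt) hij.symm)
  obtain ⟨d, rfl⟩ := Nat.exists_eq_add_of_lt hlt
  refine ⟨i, ?_⟩
  -- `(1 - ϖ^(d+1)) • ϖ^i • y = 0`
  have hd : (1 - ϖ ^ (d + 1)) • (ϖ ^ i • y) = 0 := by
    rw [sub_smul, one_smul, ← mul_smul, ← pow_add, add_comm (d + 1) i, ← add_assoc, ← h, sub_self]
  have hunit : IsUnit (1 - ϖ ^ (d + 1)) :=
    IsLocalRing.isUnit_one_sub_self_of_mem_nonunits _ (Ideal.pow_mem_of_mem _ hϖ _ (Nat.succ_pos d))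
  obtain ⟨v, hv⟩ := hunit
  have h2 := congrArg (fun z ↦ (↑v⁻¹ : R) • z) hd
  simp only [smul_zero] at h2
  rwa [← hv, ← mul_smul, Units.inv_mul, one_smul] at h2

/-! ## §4 The product `𝒟 × (M × M)` -/

/-- **Every element of `FracModR R × (M × M)` (`R` a DVR with `𝔪 = (ϖ)`, `M` finite) is killed by a power of `ϖ`.**
[cite: Howard2004HeegnerKolyvagin, Thm. 1.6.1 (arXiv p. 11, L17–28)] -/
theorem FracModR.exists_pow_smul_prod_eq_zero (R : Type) [CommRing R] [IsDomain R] [IsDiscreteValuationRing R] {ϖ : R}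
    (hϖ : IsLocalRing.maximalIdeal R = Ideal.span {ϖ}) {M : Type*} [AddCommGroup M] [Module R M] [Finite M]
    (y : FracModR R × (M × M)) : ∃ N : ℕ, ϖ ^ N • y = 0 := by
  have hmem : ϖ ∈ IsLocalRing.maximalIdeal R := by rw [hϖ]; exact Ideal.mem_span_singleton_self ϖ
  obtain ⟨N₁, h₁⟩ := FracModR.exists_pow_smul_eq_zero R hϖ y.1
  obtain ⟨N₂, h₂⟩ := exists_pow_smul_eq_zero_of_mem_maximalIdeal_of_finite hmem y.2.1
  obtain ⟨N₃, h₃⟩ := exists_pow_smul_eq_zero_of_mem_maximalIdeal_of_finite hmem y.2.2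
  refine ⟨N₁ + N₂ + N₃, Prod.ext ?_ (Prod.ext ?_ ?_)⟩
  · rw [Prod.smul_fst, Prod.fst_zero]; exact pow_smul_eq_zero_of_le ϖ h₁ (by omega)
  · rw [Prod.smul_snd, Prod.smul_fst, Prod.snd_zero, Prod.fst_zero]; exact pow_smul_eq_zero_of_le ϖ h₂ (by omega)
  · rw [Prod.smul_snd, Prod.smul_snd, Prod.snd_zero, Prod.snd_zero]; exact pow_smul_eq_zero_of_le ϖ h₃ (by omega)

end Literature.NumberTheory.GaloisCohomology.Howard2004

end
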